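import Literature.MathematicalPhysics.QuantumLattice.GrassmannTruncatedExpectation
import Literature.Probability.LatticeModels.CumulantExponentialFormula
import HarnessLib

/-!
# Truncated expectations `𝓔ᵀ(X; n)` of one even element: moments, cumulants, generating function

Trunk **QLatticeAQFT**; continues `GrassmannTruncatedExpectation.lean` (set-partition truncated
expectations on the Grassmann algebra) with the cumulant files
`Literature/Probability/LatticeModels/CumulantRecursion.lean`, `CumulantExponentialFormula.lean`.
For one element `X` of the Grassmann algebra (typically an even, spectator-free polynomial in the
fields of a block — BGM's effective potentials `V`), the normalised moments `𝓔(Xᵏ)` under the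
Gaussian integration `gaussOn e A` and the truncated expectations `𝓔ᵀ(X; k)` defined as their
cumulants; the relations (2.34)–(2.36) of Mastropietro 2008 / (2.13)–(2.14) of
Benfatto–Giuliani–Mastropietro 2006 then hold at the level of exponential generating functions.

* `gaussMoment R e A u X k` (a `def`: `u · scalarPart (gaussOn e A (Xᵏ))`, `u` normalising),
  `gaussMoment_zero`;
* `gaussTruncated R e A u X k` (a `def`: `cumulantOf (gaussMoment …) k`), `gaussTruncated_one`,
  `gaussTruncated_two`, `gaussMoment_succ` (moment–cumulant recursion),
  `egf_gaussMoment_shift` (`M' = K'M`: "`log ∫P e^{λX} = Σ λⁿ𝓔ᵀ(X;n)/n!`"),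
  `gaussTruncated_eq_truncatedOf` (agreement with the set-partition definition on `k` copies of `X`).

All theorems are one-line instances of the tree results; no named fact.

## Sources

V. Mastropietro, *Non-Perturbative Renormalization* (2008), §2.3, (2.32)–(2.36), PDF pp. 34–35 of
the held copy; bib key `Mastropietro2008`.  G. Benfatto, A. Giuliani, V. Mastropietro, Ann. Henri
Poincaré 7 (2006), (2.13)–(2.14) (arXiv p. 6 of the held copy); bib key
`BenfattoGiulianiMastropietro2006`.
-/

noncomputable section

/-! ## Truncated expectations of one even element: moments, cumulants, generating function -/

namespace Literature.MathematicalPhysics.QuantumLattice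

section QLatticeAQFT

open ExteriorAlgebra GrassmannAlgebra Literature.Probability.LatticeModels

variable (R : Type*) [CommRing R] [Algebra ℚ R] {ι : Type*} [LinearOrder ι] [Fintype ι]
  {J : Type*} [LinearOrder J] [Fintype J]

/-- The **normalised moments** `𝓔(Xᵏ) = u · scalarPart (∫ dθ e^{ψ̄Aψ} Xᵏ)` of an element `X` under
the Gaussian integration of the block `e` (`u` the inverse normalisation, `u · ε det A = 1`;
Mastropietro 2008, (2.23)). [folklore] -/
def gaussMoment (e : ι ⊕ₗ ι ↪o J) (A : Matrix ι ι R) (u : R) (X : GrassmannAlgebra R J) (k : ℕ) : R :=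
  u * scalarPart R (gaussOn R e A (X ^ k))

/-- The **truncated expectations `𝓔ᵀ(X; k)`** of one element (Mastropietro 2008, (2.35):
`𝓔ᵀ(X;n) = ∂ⁿ_λ log ∫P(dψ)e^{λX}|₀`; Benfatto–Giuliani–Mastropietro 2006, (2.14)): the cumulants
(`cumulantOf`) of the normalised moments. [folklore] -/
def gaussTruncated (e : ι ⊕ₗ ι ↪o J) (A : Matrix ι ι R) (u : R) (X : GrassmannAlgebra R J) (k : ℕ) : R :=
  cumulantOf (gaussMoment R e A u X) k

variable (e : ι ⊕ₗ ι ↪o J) (A : Matrix ι ι R) (u : R) (X : GrassmannAlgebra R J)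

/-- `𝓔(X⁰) = 1` for the normalised expectation. [folklore] -/
theorem gaussMoment_zero (hu : u * ((-1 : R) ^ (Fintype.card ι * (Fintype.card ι - 1) / 2) * A.det) = 1) :
    gaussMoment R e A u X 0 = 1 := by
  rw [gaussMoment, pow_zero, gaussOn_one, scalarPart_algebraMap, hu]

/-- `𝓔ᵀ(X;1) = 𝓔(X)` (Mastropietro (2.34)). [folklore] -/
theorem gaussTruncated_one : gaussTruncated R e A u X 1 = gaussMoment R e A u X 1 :=
  cumulantOf_one _

/-- `𝓔ᵀ(X;2) = 𝓔(X²) - 𝓔(X)²`. [folklore] -/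
theorem gaussTruncated_two (hu : u * ((-1 : R) ^ (Fintype.card ι * (Fintype.card ι - 1) / 2) * A.det) = 1) :
    gaussTruncated R e A u X 2 = gaussMoment R e A u X 2 - gaussMoment R e A u X 1 * gaussMoment R e A u X 1 :=
  cumulantOf_two _ (gaussMoment_zero R e A u X hu)

/-- **The moment–cumulant recursion for `𝓔ᵀ(X; ·)`**:
`𝓔(Xⁿ⁺¹) = Σₖ C(n,k) 𝓔ᵀ(X; k+1) 𝓔(Xⁿ⁻ᵏ)`. [folklore] -/
theorem gaussMoment_succ (hu : u * ((-1 : R) ^ (Fintype.card ι * (Fintype.card ι - 1) / 2) * A.det) = 1)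
    (n : ℕ) :
    gaussMoment R e A u X (n + 1) = ∑ k ∈ Finset.range (n + 1),
      (n.choose k : R) * gaussTruncated R e A u X (k + 1) * gaussMoment R e A u X (n - k) :=
  moment_succ_eq_sum_choose_mul_cumulantOf _ (gaussMoment_zero R e A u X hu) n

/-- **`log ∫P(dψ) e^{λX} = Σₙ λⁿ 𝓔ᵀ(X;n)/n!` at the level of exponential generating functions**
(Mastropietro 2008, (2.36); BGM 2006, (2.13)–(2.14)): `M' = K' M` for `M = Σ 𝓔(Xⁿ) λⁿ/n!`,
`K = Σ_{n≥1} 𝓔ᵀ(X;n) λⁿ/n!`. [cite: Mastropietro2008, Ch. 2 (2.36)] -/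
theorem egf_gaussMoment_shift (hu : u * ((-1 : R) ^ (Fintype.card ι * (Fintype.card ι - 1) / 2) * A.det) = 1) :
    egf (fun n => gaussMoment R e A u X (n + 1)) =
      egf (fun n => gaussTruncated R e A u X (n + 1)) * egf (gaussMoment R e A u X) :=
  egf_shift_eq_egf_cumulantOf_shift_mul _ (gaussMoment_zero R e A u X hu)

/-- The one-variable truncated expectation is the set-partition one (`truncatedOf`) of `k` copies
of `X` (all multiplicities one, Mastropietro (2.34): `𝓔ᵀ(X,…,X;n₁,…,n_p) = 𝓔ᵀ(X; n₁+⋯+n_p)`).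
[folklore] -/
theorem gaussTruncated_eq_truncatedOf (k : ℕ) :
    gaussTruncated R e A u X k =
      truncatedOf R (u • gaussOn R e A) (fun _ : Fin k => X) (fun _ _ _ => Commute.refl X) Finset.univ := by
  rw [gaussTruncated, cumulantOf, truncatedOf]
  congr 1
  funext P
  rw [Finset.noncommProd_eq_pow_card P (fun _ : Fin k => X) _ X fun _ _ => rfl, gaussMoment,
    LinearMap.smul_apply, map_smul, smul_eq_mul]

end QLatticeAQFT

end Literature.MathematicalPhysics.QuantumLattice
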